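import Summits.MatrixMultiplication.MatrixMultiplication.Theorems.FarEdgeDescentImprovableDynamics
import HarnessLib

/-!
# Far-edge descent, kernel XXXI-B: the conditional rate `0.70951…⁻` of the improvable squaring tower

Route `FarEdgeDescent`, special leaf `FiniteSaturation` (stmt-MatrixMultiplication-23739): helper
kernel, THESES-FREE and def-free.  From the core bound of kernel XXXI-A
(`FarEdgeDescentImprovableDynamics.core_bound_improvable`): IF an improvable numeric chain
`(r_j, Q_j, L_j, G_j)` (`r' = r²`, `L' = (Q+L)² − Q²`, `Q + 2L = r`, `γ' = (θ+γ)² − θ²`, `r₀ ≥ 2`,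
`3L₀ ≤ r₀`) with initial deviation `≥ c(s−1)` satisfies the virtual readout `G_j(s,t) ≤ r_j` on
every sub-tangent `(s,t)` of `y ↦ ω(1,y,1)`, THEN `s − 1 ≤ C(1−t)^κ`, `κ = log₂(4/3)`
(`virtualPowerBound_of_improvableChain`), so `e(x) ≤ C'x^(−κ/(1−κ))` and `RateBeyond θ` for
every `θ < κ/(1−κ) = log(4/3)/log(3/2) = 0.70951…` (`rateBeyond_of_improvableChain`), certified
floor `7/10` (`improvableOrder_gt`, `(4/3)^17 > 2^7`).  The chain's existence is Pan's improvable
squaring (Pan 1984 §16; Stothers 2010 Thm. 8; Knuth Ex. 67) and is NOT asserted here: it needs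
the pending Literature definition of improvable approximate realisations plus one chain kernel in
the style of XXX-A.  With it, (h₁)'s rate frontier would move from `0.44860…` (XXX-C4,
unconditional) to `0.70951…`.

References: Pan 1984 (LNCS 179) §16–17; Stothers 2010, Thm. 8; Knuth TAOCP 2 §4.6.4 Ex. 67;
Lotti–Romani 1983, Prop. 4.1; Coppersmith–Winograd 1982.
Tags: `FiniteSaturation` (h₁) NEC · WEAKER-CONDITIONAL.
-/

set_option linter.dupNamespace false

noncomputable section

open scoped BigOperators

namespace Summit.MatrixMultiplication.MatrixMultiplication.Theorems.FarEdgeDescentImprovableRate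

open Literature.Computability.AlgebraicComplexity
open Summit.MatrixMultiplication.MatrixMultiplication.Theorems.FarEdgeDescentImprovableDynamics

variable (K : Type) [Field K]

/-- `0 < κ = log₂(4/3) < 1`. [folklore] -/
theorem improvableKappa_pos_lt_one :
    0 < Real.logb 2 ((4 : ℝ) / 3) ∧ Real.logb 2 ((4 : ℝ) / 3) < 1 := by
  refine ⟨Real.logb_pos (by norm_num) (by norm_num), ?_⟩
  have h := Real.logb_lt_logb (b := 2) (by norm_num) (by norm_num : (0 : ℝ) < 4 / 3)
    (by norm_num : (4 : ℝ) / 3 < 2)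
  rwa [Real.logb_self_eq_one (by norm_num)] at h

/-- **The improvable order exceeds `7/10`**: `κ/(1−κ) > 0.7`, `κ = log₂(4/3) > 7/17` because
`(4/3)^17 > 2^7`; exactly `κ/(1−κ) = log(4/3)/log(3/2) = 0.70951…`. [folklore] -/
theorem improvableOrder_gt :
    (7 : ℝ) / 10 < Real.logb 2 ((4 : ℝ) / 3) / (1 - Real.logb 2 ((4 : ℝ) / 3)) := by
  have h1 : Real.log ((2 : ℝ) ^ 7) < Real.log (((4 : ℝ) / 3) ^ 17) :=
    Real.log_lt_log (by positivity) (by norm_num)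
  rw [Real.log_pow, Real.log_pow] at h1
  push_cast at h1
  have h2 : 0 < Real.log 2 := Real.log_pos (by norm_num)
  have hκ : (7 : ℝ) / 17 < Real.logb 2 ((4 : ℝ) / 3) := by
    rw [Real.logb, lt_div_iff₀ h2]
    linarith
  have hκ1 := improvableKappa_pos_lt_one.2
  rw [lt_div_iff₀ (by linarith)]
  linarith

section Chain

variable (r Q L : ℕ → ℕ) (G : ℕ → ℝ → ℝ → ℝ)

/-- **Wedge from an improvable chain.**  Under the hypotheses of kernel XXXI-A and an initial
deviation `≥ c(s−1)` (`c > 0`) on sub-tangents: `s − 1 ≤ C(1−t)^(log₂(4/3))` with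
`C = (3/c)·(6 log r₀)^(log₂(4/3))`. [cite: Pan1984, Props. 16.2–16.5, Thm. 17.1; Stothers2010, Thm. 8;
LottiRomani1983, Thm. 3.1, Prop. 4.1] -/
theorem virtualPowerBound_of_improvableChain (hr0 : 2 ≤ r 0)
    (hsum : ∀ j, Q j + 2 * L j = r j) (hQ1 : ∀ j, 1 ≤ Q j)
    (hm0 : 3 * L 0 ≤ r 0) (hL : ∀ j, L (j + 1) = (Q j + L j) ^ 2 - Q j ^ 2)
    (hr : ∀ j, r (j + 1) = r j ^ 2) (hG0 : ∀ s t : ℝ, 0 ≤ G 0 s t)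
    (hG : ∀ j (s t : ℝ), G (j + 1) s t = (((Q j : ℕ) : ℝ) ^ t + G j s t) ^ 2 - (((Q j : ℕ) : ℝ) ^ t) ^ 2)
    (hread : ∀ j (s t : ℝ), (∀ y : ℝ, 0 ≤ y → s + y * t ≤ omegaRect K 1 y 1) → G j s t ≤ r j)
    {c : ℝ} (hc : 0 < c)
    (hD0 : ∀ s t : ℝ, 0 ≤ t → t ≤ 1 → 1 ≤ s → s ≤ 2 →
      (∀ y : ℝ, 0 ≤ y → s + y * t ≤ omegaRect K 1 y 1) →
      c * (s - 1) ≤ G 0 s t / r 0 - (L 0 : ℝ) / r 0) :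
    ∃ C : ℝ, 0 ≤ C ∧ ∀ s t : ℝ, 0 ≤ t → t ≤ 1 → 1 ≤ s → s ≤ 2 →
      (∀ y : ℝ, 0 ≤ y → s + y * t ≤ omegaRect K 1 y 1) →
      s - 1 ≤ C * (1 - t) ^ Real.logb 2 ((4 : ℝ) / 3) := by
  obtain ⟨hκ0, -⟩ := improvableKappa_pos_lt_one
  have hr0R : (2 : ℝ) ≤ r 0 := by exact_mod_cast hr0
  have hℓ : 0 < Real.log (r 0) := Real.log_pos (by linarith)
  refine ⟨3 / c * (6 * Real.log (r 0)) ^ Real.logb 2 ((4 : ℝ) / 3), by positivity, ?_⟩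
  intro s t ht0 ht1 hs1 hs2 hst
  have hu0 : 0 ≤ 1 - t := by linarith
  have hD := hD0 s t ht0 ht1 hs1 hs2 hst
  -- core bound in the form  s − 1 < (2/c)(3/4)^n
  have cv : ∀ n : ℕ, (1 - t) * (2 ^ n * Real.log (r 0)) ≤ 1 / 6 →
      s - 1 < 2 / c * ((3 : ℝ) / 4) ^ n := by
    intro n hn
    have h := core_bound_improvable K r Q L G hsum hQ1 hm0 hL hr hG0 hG hread ht1 hst hD n hn
    have hp : (0 : ℝ) < ((4 : ℝ) / 3) ^ n := by positivity
    have e : ((3 : ℝ) / 4) ^ n * ((4 : ℝ) / 3) ^ n = 1 := by rw [← mul_pow]; norm_num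
    have h' : c * (s - 1) < 2 * ((3 : ℝ) / 4) ^ n := by
      have := mul_lt_mul_of_pos_right h (show (0 : ℝ) < ((3 : ℝ) / 4) ^ n by positivity)
      calc c * (s - 1) = ((4 : ℝ) / 3) ^ n * (c * (s - 1)) * ((3 : ℝ) / 4) ^ n := by
            rw [mul_comm (((4 : ℝ) / 3) ^ n), mul_assoc, mul_comm (((4 : ℝ) / 3) ^ n), e, mul_one]
        _ < 2 * ((3 : ℝ) / 4) ^ n := this
    rw [show 2 / c * ((3 : ℝ) / 4) ^ n = 2 * ((3 : ℝ) / 4) ^ n / c by ring, lt_div_iff₀ hc]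
    linarith
  -- a priori bound  c(s−1) ≤ 1
  have hv1 : c * (s - 1) ≤ 1 := by
    obtain ⟨-, hm00, -, -, -⟩ := improvable_normalForm r Q L hsum hQ1 hm0 hL hr 0
    obtain ⟨-, -, -, -, hγ1, -⟩ :=
      improvable_virtualForm K r Q L G hsum hQ1 hm0 hL hr hG0 hG hread ht1 hst 0
    linarith
  by_cases hu : 1 - t = 0
  · have hv : s - 1 ≤ 0 := by
      by_contra hpos
      push Not at hpos
      obtain ⟨n, hn⟩ := exists_pow_lt_of_lt_one (show 0 < c * (s - 1) / 2 by positivity)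
        (show ((3 : ℝ) / 4) < 1 by norm_num)
      have h := cv n (by rw [hu]; norm_num)
      rw [show 2 / c * ((3 : ℝ) / 4) ^ n = 2 * ((3 : ℝ) / 4) ^ n / c by ring, lt_div_iff₀ hc] at h
      linarith
    exact le_trans hv (by positivity)
  · have hupos : 0 < 1 - t := lt_of_le_of_ne hu0 (Ne.symm hu)
    have hXpos : 0 < 1 / (6 * Real.log (r 0) * (1 - t)) := by positivity
    have emul : (6 * Real.log (r 0) * (1 - t)) ^ Real.logb 2 ((4 : ℝ) / 3) =
        (6 * Real.log (r 0)) ^ Real.logb 2 ((4 : ℝ) / 3) * (1 - t) ^ Real.logb 2 ((4 : ℝ) / 3) :=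
      Real.mul_rpow (by positivity) hu0
    by_cases hsmall : 6 * Real.log (r 0) * (1 - t) ≤ 1
    · -- X = 1/(6ℓu) ≥ 1, n = ⌊log₂ X⌋
      have hX1 : (1 : ℝ) ≤ 1 / (6 * Real.log (r 0) * (1 - t)) := by
        rw [le_div_iff₀ (by positivity)]; linarith
      have hl0 : 0 ≤ Real.logb 2 (1 / (6 * Real.log (r 0) * (1 - t))) :=
        Real.logb_nonneg (by norm_num) hX1
      have hnle : (⌊Real.logb 2 (1 / (6 * Real.log (r 0) * (1 - t)))⌋₊ : ℝ) ≤
          Real.logb 2 (1 / (6 * Real.log (r 0) * (1 - t))) := Nat.floor_le hl0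
      have hnlt := Nat.lt_floor_add_one (Real.logb 2 (1 / (6 * Real.log (r 0) * (1 - t))))
      have h2n : (2 : ℝ) ^ ⌊Real.logb 2 (1 / (6 * Real.log (r 0) * (1 - t)))⌋₊ ≤
          1 / (6 * Real.log (r 0) * (1 - t)) := by
        have := Real.rpow_le_rpow_of_exponent_le (by norm_num : (1 : ℝ) ≤ 2) hnle
        rwa [Real.rpow_natCast, Real.rpow_logb (by norm_num) (by norm_num) hXpos] at this
      have hn : (1 - t) * (2 ^ ⌊Real.logb 2 (1 / (6 * Real.log (r 0) * (1 - t)))⌋₊ *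
          Real.log (r 0)) ≤ 1 / 6 := by
        calc (1 - t) * (2 ^ ⌊Real.logb 2 (1 / (6 * Real.log (r 0) * (1 - t)))⌋₊ * Real.log (r 0))
            ≤ (1 - t) * (1 / (6 * Real.log (r 0) * (1 - t)) * Real.log (r 0)) := by gcongr
          _ = 1 / 6 := by field_simp
      have hv := cv _ hn
      -- (3/4)^n ≤ (3/4)^(log₂X − 1) = (4/3)·X^(−κ) = (4/3)(6ℓu)^κ
      have e1 : ((3 : ℝ) / 4) ^ ⌊Real.logb 2 (1 / (6 * Real.log (r 0) * (1 - t)))⌋₊ ≤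
          ((3 : ℝ) / 4) ^ (Real.logb 2 (1 / (6 * Real.log (r 0) * (1 - t))) - 1) := by
        have h := Real.rpow_le_rpow_of_exponent_ge (by norm_num : (0 : ℝ) < 3 / 4)
          (by norm_num : (3 : ℝ) / 4 ≤ 1)
          (show Real.logb 2 (1 / (6 * Real.log (r 0) * (1 - t))) - 1 ≤
            ((⌊Real.logb 2 (1 / (6 * Real.log (r 0) * (1 - t)))⌋₊ : ℕ) : ℝ) by linarith)
        rwa [Real.rpow_natCast] at h
      have e2 : ((3 : ℝ) / 4) ^ (Real.logb 2 (1 / (6 * Real.log (r 0) * (1 - t))) - 1) =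
          4 / 3 * (6 * Real.log (r 0) * (1 - t)) ^ Real.logb 2 ((4 : ℝ) / 3) := by
        rw [Real.rpow_sub (by norm_num), Real.rpow_one]
        have h34 : ((3 : ℝ) / 4) ^ Real.logb 2 (1 / (6 * Real.log (r 0) * (1 - t))) =
            (6 * Real.log (r 0) * (1 - t)) ^ Real.logb 2 ((4 : ℝ) / 3) := by
          rw [Real.rpow_def_of_pos (by norm_num), Real.rpow_def_of_pos (by positivity), Real.logb,
            Real.logb, one_div, Real.log_inv,
            show Real.log ((3 : ℝ) / 4) = -Real.log ((4 : ℝ) / 3) by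
              rw [← Real.log_inv]; norm_num]
          congr 1
          have h2 : Real.log 2 ≠ 0 := Real.log_ne_zero_of_pos_of_ne_one (by norm_num) (by norm_num)
          field_simp
        rw [h34]
        ring
      rw [e2, emul] at e1
      have hfin : 2 / c * ((3 : ℝ) / 4) ^ ⌊Real.logb 2 (1 / (6 * Real.log (r 0) * (1 - t)))⌋₊ ≤
          3 / c * (6 * Real.log (r 0)) ^ Real.logb 2 ((4 : ℝ) / 3) *
            (1 - t) ^ Real.logb 2 ((4 : ℝ) / 3) := by
        have hc2 : (0 : ℝ) ≤ 2 / c := by positivity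
        have := mul_le_mul_of_nonneg_left e1 hc2
        have hP : 0 ≤ (6 * Real.log (r 0)) ^ Real.logb 2 ((4 : ℝ) / 3) *
            (1 - t) ^ Real.logb 2 ((4 : ℝ) / 3) := by positivity
        have e3 : 2 / c * (4 / 3 * ((6 * Real.log (r 0)) ^ Real.logb 2 ((4 : ℝ) / 3) *
            (1 - t) ^ Real.logb 2 ((4 : ℝ) / 3))) = 8 / 3 / c *
            ((6 * Real.log (r 0)) ^ Real.logb 2 ((4 : ℝ) / 3) * (1 - t) ^ Real.logb 2 ((4 : ℝ) / 3)) := by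
          ring
        have e4 : 8 / 3 / c * ((6 * Real.log (r 0)) ^ Real.logb 2 ((4 : ℝ) / 3) *
            (1 - t) ^ Real.logb 2 ((4 : ℝ) / 3)) ≤ 3 / c *
            ((6 * Real.log (r 0)) ^ Real.logb 2 ((4 : ℝ) / 3) * (1 - t) ^ Real.logb 2 ((4 : ℝ) / 3)) :=
          mul_le_mul_of_nonneg_right (by rw [div_le_div_iff_of_pos_right hc]; norm_num) hP
        linarith
      linarith
    · -- u large: s − 1 ≤ 1/c ≤ (1/c)(6ℓu)^κ
      push Not at hsmall
      have h1 : (1 : ℝ) ≤ (6 * Real.log (r 0) * (1 - t)) ^ Real.logb 2 ((4 : ℝ) / 3) :=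
        Real.one_le_rpow hsmall.le hκ0.le
      rw [emul] at h1
      have hv : s - 1 ≤ 1 / c := by rw [le_div_iff₀ hc]; linarith
      have h3 : 1 / c ≤ 3 / c * ((6 * Real.log (r 0)) ^ Real.logb 2 ((4 : ℝ) / 3) *
          (1 - t) ^ Real.logb 2 ((4 : ℝ) / 3)) := by
        rw [div_mul_eq_mul_div, div_le_div_iff_of_pos_right hc]
        nlinarith
      linarith

/-- **Conditional rate `0.70951…⁻`.**  Under the improvable-chain hypotheses:
`RateBeyond θ` for every `θ < κ/(1−κ)`, `κ = log₂(4/3)` (`κ/(1−κ) = log(4/3)/log(3/2)`), in the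
route's shape `∃ δ > θ, ∃ C, ∀ k ≥ 1, e(k) ≤ C·k^(−δ)`. [cite: Pan1984, Props. 16.2–16.5, Thm. 17.1;
Stothers2010, Thm. 8; LottiRomani1983, Prop. 4.1] -/
theorem rateBeyond_of_improvableChain (hr0 : 2 ≤ r 0)
    (hsum : ∀ j, Q j + 2 * L j = r j) (hQ1 : ∀ j, 1 ≤ Q j)
    (hm0 : 3 * L 0 ≤ r 0) (hL : ∀ j, L (j + 1) = (Q j + L j) ^ 2 - Q j ^ 2)
    (hr : ∀ j, r (j + 1) = r j ^ 2) (hG0 : ∀ s t : ℝ, 0 ≤ G 0 s t)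
    (hG : ∀ j (s t : ℝ), G (j + 1) s t = (((Q j : ℕ) : ℝ) ^ t + G j s t) ^ 2 - (((Q j : ℕ) : ℝ) ^ t) ^ 2)
    (hread : ∀ j (s t : ℝ), (∀ y : ℝ, 0 ≤ y → s + y * t ≤ omegaRect K 1 y 1) → G j s t ≤ r j)
    {c : ℝ} (hc : 0 < c)
    (hD0 : ∀ s t : ℝ, 0 ≤ t → t ≤ 1 → 1 ≤ s → s ≤ 2 →
      (∀ y : ℝ, 0 ≤ y → s + y * t ≤ omegaRect K 1 y 1) →
      c * (s - 1) ≤ G 0 s t / r 0 - (L 0 : ℝ) / r 0)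
    {θ : ℝ} (hθ : θ < Real.logb 2 ((4 : ℝ) / 3) / (1 - Real.logb 2 ((4 : ℝ) / 3))) :
    ∃ δ C : ℝ, θ < δ ∧ ∀ k : ℕ, 1 ≤ k →
      omegaRect K 1 k 1 - (k + 1) ≤ C * (k : ℝ) ^ (-δ) := by
  obtain ⟨C, hC, hV⟩ :=
    virtualPowerBound_of_improvableChain K r Q L G hr0 hsum hQ1 hm0 hL hr hG0 hG hread hc hD0
  obtain ⟨hκ0, hκ1⟩ := improvableKappa_pos_lt_one
  refine ⟨_, (1 - Real.logb 2 ((4 : ℝ) / 3)) * (C * Real.logb 2 ((4 : ℝ) / 3) ^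
    Real.logb 2 ((4 : ℝ) / 3)) ^ (1 / (1 - Real.logb 2 ((4 : ℝ) / 3))), hθ, fun k hk => ?_⟩
  have hkpos : (0 : ℝ) < k := by exact_mod_cast hk
  exact FarEdgeDescentVirtualPoint.excess_le_const_mul_rpow_of_virtualPowerBound K hC hκ0 hκ1 hV hkpos

/-- **Conditional `RateBeyond θ` for every `θ ≤ 7/10`** under the improvable-chain hypotheses.
[cite: Pan1984, Thm. 17.1; Stothers2010, Thm. 8] -/
theorem rateBeyond_seven_tenths_of_improvableChain (hr0 : 2 ≤ r 0)
    (hsum : ∀ j, Q j + 2 * L j = r j) (hQ1 : ∀ j, 1 ≤ Q j)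
    (hm0 : 3 * L 0 ≤ r 0) (hL : ∀ j, L (j + 1) = (Q j + L j) ^ 2 - Q j ^ 2)
    (hr : ∀ j, r (j + 1) = r j ^ 2) (hG0 : ∀ s t : ℝ, 0 ≤ G 0 s t)
    (hG : ∀ j (s t : ℝ), G (j + 1) s t = (((Q j : ℕ) : ℝ) ^ t + G j s t) ^ 2 - (((Q j : ℕ) : ℝ) ^ t) ^ 2)
    (hread : ∀ j (s t : ℝ), (∀ y : ℝ, 0 ≤ y → s + y * t ≤ omegaRect K 1 y 1) → G j s t ≤ r j)
    {c : ℝ} (hc : 0 < c)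
    (hD0 : ∀ s t : ℝ, 0 ≤ t → t ≤ 1 → 1 ≤ s → s ≤ 2 →
      (∀ y : ℝ, 0 ≤ y → s + y * t ≤ omegaRect K 1 y 1) →
      c * (s - 1) ≤ G 0 s t / r 0 - (L 0 : ℝ) / r 0)
    {θ : ℝ} (hθ : θ ≤ 7 / 10) :
    ∃ δ C : ℝ, θ < δ ∧ ∀ k : ℕ, 1 ≤ k →
      omegaRect K 1 k 1 - (k + 1) ≤ C * (k : ℝ) ^ (-δ) :=
  rateBeyond_of_improvableChain K r Q L G hr0 hsum hQ1 hm0 hL hr hG0 hG hread hc hD0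
    (lt_of_le_of_lt hθ improvableOrder_gt)

end Chain

end Summit.MatrixMultiplication.MatrixMultiplication.Theorems.FarEdgeDescentImprovableRate

end
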